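import Summits.ValiantsHypothesis.ValiantsHypothesis.Theorems.LacunarySymmetroidMatrixDescartesCensusDefs
import Summits.ValiantsHypothesis.ValiantsHypothesis.Theorems.LacunarySymmetroidMatrixDescartesStubNegRoots
import Summits.ValiantsHypothesis.ValiantsHypothesis.Theorems.LacunarySymmetroidMatrixDescartesStubDescartesCeiling
import Summits.ValiantsHypothesis.ValiantsHypothesis.Theorems.MatrixDescartes.Negative.MatrixDescartesWitness24

/-!
# `MatrixDescartes` — census certificates: how an engine-found extremiser becomes a tree theorem; rows at (2,4)

HONEST FRAMING.  Object-search cell `pub-symmetroid`, crux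
`Summit.ValiantsHypothesis.ValiantsHypothesis.Theses.LacunarySymmetroid.MatrixDescartes` (ledger item
`stmt-ValiantsHypothesis-18050`).  This file proves no bound toward the crux and claims nothing about
`VP ≠ VNP`.  It supplies (a) the CERTIFICATE LEMMAS against which the census engines' extremisers are checked
in the kernel — a lacunary symmetric pencil `(d, S)` with rational data, together with rational test points,
yields `N ≤ Z(d, S)` (`Z` = number of distinct real zeros of `det (∑ l, X ^ (d l) • S l)`, the crux's
currency) once the signs (or vanishing) of finitely many determinants of explicit rational matrices are
verified by `norm_num`; and (b) the first CERTIFIED ROWS of the census table, at the format `(m, K) = (2, 4)`: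
positive zeros `M₊(2,4) = 9 = C(5,2) − 1` (Descartes ceiling, tree `stub_descartesCeiling`, attained by the
disprover's integer witness `(d₂₄, S₂₄)`, tree `nine_le_card_posRoots_F₂₄`) — a CLOSED row; all real zeros
`10 ≤ M(2,4) ≤ 19` (the same witness has a tenth, negative, real zero in `(−6, −5)`: new certificate
`ten_le_card_roots_F₂₄`; ceiling `2·C(5,2) − 1`).

Certificate shapes (engine output ↦ theorem):
* `le_card_roots_pencil_of_alternating d S N τ hτ halt`: `τ : Fin (N+1) → ℝ` strictly increasing (ANY
  signs), `halt j : det (∑ l, (τ j)^(d l) • S l) * det (∑ l, (τ (j+1))^(d l) • S l) < 0` ⟹ `N ≤ Z(d,S)`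
  (intermediate value theorem per gap; roots of odd multiplicity);
* `le_card_roots_pencil_of_roots d S N r hr hroot t₀ hne`: `N` strictly increasing exact roots plus one
  non-root `t₀` ⟹ `N ≤ Z(d,S)` (for extremisers with roots of even multiplicity, e.g. the `K = 2`
  extremisers `X^a • diag(−rᵢ) + X^(a+2) • 1`, double root at `0`);
* `not_realRootLawAt_of_witness`: a symmetric witness with `B < Z` refutes the row `RealRootLawAt m K B`;
* `det_fin_four`: the `4 × 4` Leibniz expansion (for `m = 4` certificates; Mathlib has `det_fin_two/three` only).
The row predicates are `RealRootLawAt` (Defs module `LacunarySymmetroidMatrixDescartesCensusDefs`) and the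
disprover's `PosRootLawAt` (`MatrixDescartesWitness24`).  [folklore] throughout: Descartes' rule of signs and
the intermediate value theorem.
-/

-- `Summit.ValiantsHypothesis.ValiantsHypothesis.…` repeats a component by the D-0017 layout
-- (single-conjunct summit), which the `dupNamespace` linter flags; the name is mandated.
set_option linter.dupNamespace false

namespace Summit.ValiantsHypothesis.ValiantsHypothesis.Theorems.LacunarySymmetroidMatrixDescartes.Census

open Summit.ValiantsHypothesis.ValiantsHypothesis.Theorems.MatrixDescartes.Negative (PosRootLawAt d₂₄ S₂₄
  S₂₄_symm eval_det_F₂₄ nine_le_card_posRoots_F₂₄)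
open Summit.ValiantsHypothesis.ValiantsHypothesis.Theorems.SymmetroidDescartes (eval_det_pencil)
open scoped BigOperators Matrix
open Polynomial

/-! ## Certificate lemmas -/

/-- **`4 × 4` Leibniz expansion** (24 signed products; Mathlib stops at `Matrix.det_fin_three`), used by the
census certificate generator for formats with `m = 4`: after it, a sign claim about `det` of an explicit rational
matrix is pure arithmetic for `norm_num`. [folklore] -/
theorem det_fin_four {R : Type*} [CommRing R] (A : Matrix (Fin 4) (Fin 4) R) :
    A.det =
      A 0 0 * A 1 1 * A 2 2 * A 3 3 - A 0 0 * A 1 1 * A 2 3 * A 3 2 - A 0 0 * A 1 2 * A 2 1 * A 3 3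
      + A 0 0 * A 1 2 * A 2 3 * A 3 1 + A 0 0 * A 1 3 * A 2 1 * A 3 2
      - A 0 0 * A 1 3 * A 2 2 * A 3 1 - A 0 1 * A 1 0 * A 2 2 * A 3 3
      + A 0 1 * A 1 0 * A 2 3 * A 3 2 + A 0 1 * A 1 2 * A 2 0 * A 3 3
      - A 0 1 * A 1 2 * A 2 3 * A 3 0 - A 0 1 * A 1 3 * A 2 0 * A 3 2
      + A 0 1 * A 1 3 * A 2 2 * A 3 0 + A 0 2 * A 1 0 * A 2 1 * A 3 3
      - A 0 2 * A 1 0 * A 2 3 * A 3 1 - A 0 2 * A 1 1 * A 2 0 * A 3 3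
      + A 0 2 * A 1 1 * A 2 3 * A 3 0 + A 0 2 * A 1 3 * A 2 0 * A 3 1
      - A 0 2 * A 1 3 * A 2 1 * A 3 0 - A 0 3 * A 1 0 * A 2 1 * A 3 2
      + A 0 3 * A 1 0 * A 2 2 * A 3 1 + A 0 3 * A 1 1 * A 2 0 * A 3 2
      - A 0 3 * A 1 1 * A 2 2 * A 3 0 - A 0 3 * A 1 2 * A 2 0 * A 3 1
      + A 0 3 * A 1 2 * A 2 1 * A 3 0 := by
  rw [Matrix.det_succ_row_zero]
  simp [Fin.sum_univ_four, Matrix.det_fin_three, Matrix.submatrix_apply, Fin.succAbove]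
  ring

/-- **Alternation certificate (all real zeros).**  If a real polynomial `p` changes sign between
consecutive points of a strictly increasing sequence `τ 0 < τ 1 < … < τ N` of reals (any signs), then `p`
has at least `N` distinct real roots (intermediate value theorem in each gap).  The all-real-zeros twin of
the tree's `le_card_posRoots_of_alternating`. [folklore] -/
theorem le_card_roots_of_alternating (p : ℝ[X]) (N : ℕ) (τ : Fin (N + 1) → ℝ) (hτ : StrictMono τ)
    (halt : ∀ j : Fin N, p.eval (τ j.castSucc) * p.eval (τ j.succ) < 0) :
    N ≤ p.roots.toFinset.card := by
  have hroot : ∀ j : Fin N, ∃ r, τ j.castSucc < r ∧ r < τ j.succ ∧ p.IsRoot r := by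
    intro j
    have hlt : τ j.castSucc < τ j.succ := hτ (by exact Fin.castSucc_lt_succ)
    have hcont : ContinuousOn (fun x => p.eval x) (Set.Icc (τ j.castSucc) (τ j.succ)) :=
      p.continuous.continuousOn
    rcases mul_neg_iff.1 (halt j) with ⟨h1, h2⟩ | ⟨h1, h2⟩
    · obtain ⟨r, ⟨hr1, hr2⟩, hr⟩ := intermediate_value_Ioo' hlt.le hcont ⟨h2, h1⟩
      exact ⟨r, hr1, hr2, hr⟩
    · obtain ⟨r, ⟨hr1, hr2⟩, hr⟩ := intermediate_value_Ioo hlt.le hcont ⟨h1, h2⟩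
      exact ⟨r, hr1, hr2, hr⟩
  choose r hr₁ hr₂ hr₃ using hroot
  have hmono : StrictMono r := by
    intro i j hij
    have hij' : (i : ℕ) < j := hij
    calc r i < τ i.succ := hr₂ i
      _ ≤ τ j.castSucc := hτ.monotone (by
          rw [Fin.le_def, Fin.val_succ, Fin.val_castSucc]
          exact hij')
      _ < r j := hr₁ j
  calc N = (Finset.univ : Finset (Fin N)).card := by simp
    _ ≤ p.roots.toFinset.card := by
      refine Finset.card_le_card_of_injOn r (fun j _ => ?_) hmono.injective.injOn
      have hp : p ≠ 0 := by
        rintro rfl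
        exact (lt_irrefl (0 : ℝ)) (by simpa using halt j)
      simp only [Finset.mem_coe, Multiset.mem_toFinset, Polynomial.mem_roots hp]
      exact hr₃ j

/-- **Alternation certificate for a pencil**, in evaluated form: if the real determinants
`det (∑ l, (τ j)^(d l) • S l)` alternate in sign along strictly increasing reals `τ 0 < … < τ N`, the
pencil has at least `N` distinct real zeros (tree `eval_det_pencil` + the previous lemma).  This is the
shape a census engine's extremiser certificate is checked in (`norm_num` on rational data). [folklore] -/
theorem le_card_roots_pencil_of_alternating {m K : ℕ} (d : Fin K → ℕ)
    (S : Fin K → Matrix (Fin m) (Fin m) ℝ) (N : ℕ) (τ : Fin (N + 1) → ℝ) (hτ : StrictMono τ)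
    (halt : ∀ j : Fin N,
      (∑ l, τ j.castSucc ^ d l • S l).det * (∑ l, τ j.succ ^ d l • S l).det < 0) :
    N ≤ (Matrix.det (∑ l, ((Polynomial.X : Polynomial ℝ) ^ d l) • (S l).map Polynomial.C)
      ).roots.toFinset.card := by
  refine le_card_roots_of_alternating _ N τ hτ fun j => ?_
  rw [eval_det_pencil, eval_det_pencil]
  exact halt j

/-- **Root-list certificate**: a strictly increasing list of `N` reals at which a nonzero polynomial
vanishes shows it has at least `N` distinct real roots (use when an extremiser has roots of even
multiplicity, which sign alternation cannot see). [folklore] -/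
theorem le_card_roots_of_roots (p : ℝ[X]) (hp : p ≠ 0) (N : ℕ) (r : Fin N → ℝ) (hr : StrictMono r)
    (hroot : ∀ i, p.IsRoot (r i)) : N ≤ p.roots.toFinset.card := by
  calc N = (Finset.univ : Finset (Fin N)).card := by simp
    _ ≤ p.roots.toFinset.card := by
      refine Finset.card_le_card_of_injOn r (fun i _ => ?_) hr.injective.injOn
      simp only [Finset.mem_coe, Multiset.mem_toFinset, Polynomial.mem_roots hp]
      exact hroot i

/-- **Root-list certificate for a pencil**, in evaluated form: `N` strictly increasing reals `r i` with
`det (∑ l, (r i)^(d l) • S l) = 0`, plus one real `t₀` where that determinant is nonzero (so the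
determinant polynomial is not identically zero), give at least `N` distinct real zeros. [folklore] -/
theorem le_card_roots_pencil_of_roots {m K : ℕ} (d : Fin K → ℕ) (S : Fin K → Matrix (Fin m) (Fin m) ℝ)
    (N : ℕ) (r : Fin N → ℝ) (hr : StrictMono r) (hroot : ∀ i, (∑ l, r i ^ d l • S l).det = 0)
    (t₀ : ℝ) (hne : (∑ l, t₀ ^ d l • S l).det ≠ 0) :
    N ≤ (Matrix.det (∑ l, ((Polynomial.X : Polynomial ℝ) ^ d l) • (S l).map Polynomial.C)
      ).roots.toFinset.card := by
  refine le_card_roots_of_roots _ (fun h => hne ?_) N r hr fun i => ?_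
  · have h0 := congrArg (Polynomial.eval t₀) h
    rwa [eval_det_pencil, Polynomial.eval_zero] at h0
  · rw [Polynomial.IsRoot.def, eval_det_pencil]
    exact hroot i

/-- A symmetric witness with more than `B` real zeros kills the row `RealRootLawAt m K B`. [folklore] -/
theorem not_realRootLawAt_of_witness {m K B : ℕ} (d : Fin K → ℕ) (S : Fin K → Matrix (Fin m) (Fin m) ℝ)
    (hS : ∀ l, (S l).IsSymm)
    (hB : B < (Matrix.det (∑ l, ((Polynomial.X : Polynomial ℝ) ^ d l) • (S l).map Polynomial.C)
      ).roots.toFinset.card) :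
    ¬ RealRootLawAt m K B :=
  fun h => absurd (h d S hS) (not_le.2 hB)

/-! ## Certified rows at `(m, K) = (2, 4)` -/

/-- **Row `(2,4)`, positive zeros, CLOSED: `M₊(2,4) = 9`.**  The Descartes ceiling `C(5,2) − 1 = 9` holds for
every pencil (tree `stub_descartesCeiling`) and is attained by the disprover's symmetric integer
witness `(d₂₄, S₂₄)` (tree `nine_le_card_posRoots_F₂₄`). [folklore] -/
theorem posRootLaw_two_four_sharp : PosRootLawAt 2 4 9 ∧ ¬ PosRootLawAt 2 4 8 := by
  refine ⟨fun d S _ => ?_, fun h => ?_⟩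
  · have h1 := stub_descartesCeiling 4 2 (by norm_num) d S
    have hc : Nat.choose (2 + 4 - 1) 2 = 10 := by decide
    rw [hc] at h1
    omega
  · have h9 := nine_le_card_posRoots_F₂₄.trans (h d₂₄ S₂₄ S₂₄_symm)
    norm_num at h9

/-- **New census datum: `Z(d₂₄, S₂₄) ≥ 10`** — besides its nine positive zeros the `(2,4)` witness has a
negative real zero in `(−6, −5)`: `det F₂₄` alternates in sign (`+,−,+,−,+,−,+,−,+,−,+`) along the eleven
real test points `−6, −5, 3/7, 1/2, 2/3, 4/5, 6/5, 2, 3, 5, 7` (`norm_num` certificate on the closed form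
`eval_det_F₂₄`); hence `M(2,4) ≥ 10` in the crux's all-real-zeros currency. [folklore] -/
theorem ten_le_card_roots_F₂₄ :
    10 ≤ (Matrix.det (∑ l, ((Polynomial.X : Polynomial ℝ) ^ d₂₄ l) • (S₂₄ l).map Polynomial.C)
      ).roots.toFinset.card := by
  refine le_card_roots_of_alternating _ 10
    (![-6, -5, 3 / 7, 1 / 2, 2 / 3, 4 / 5, 6 / 5, 2, 3, 5, 7] : Fin 11 → ℝ) ?_ ?_
  · refine Fin.strictMono_iff_lt_succ.2 fun j => ?_
    fin_cases j <;> simp <;> norm_num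
  · intro j
    fin_cases j <;> simp only [eval_det_F₂₄] <;> simp <;> norm_num

/-- **Row `(2,4)`, all real zeros, lower end: `¬ (M(2,4) ≤ 9)`.** [folklore] -/
theorem not_realRootLawAt_two_four_nine : ¬ RealRootLawAt 2 4 9 :=
  not_realRootLawAt_of_witness d₂₄ S₂₄ S₂₄_symm (lt_of_lt_of_le (by norm_num) ten_le_card_roots_F₂₄)

/-- **Row `(2,4)`, all real zeros, upper end: `M(2,4) ≤ 19`** (Descartes ceiling `2·C(5,2) − 1`: positive zeros,
positive zeros of the reflected pencil `(−1)^(d l) • S l`, and `0`; tree `stub_descartesCeiling`, `stub_negRoots`).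
[folklore] -/
theorem realRootLawAt_two_four_nineteen : RealRootLawAt 2 4 19 := by
  intro d S _
  have h1 := stub_descartesCeiling 4 2 (by norm_num) d S
  have h2 := stub_descartesCeiling 4 2 (by norm_num) d (fun l => ((-1 : ℝ) ^ d l) • S l)
  have h3 := stub_negRoots 4 2 d S
  have hc : Nat.choose (2 + 4 - 1) 2 = 10 := by decide
  rw [hc] at h1 h2
  omega

end Summit.ValiantsHypothesis.ValiantsHypothesis.Theorems.LacunarySymmetroidMatrixDescartes.Census
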